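import Mathlib
import Summits.Parity.GeneralizedHardyLittlewood.Theorems.FordMaynardSieveConst01651SieveConst01651BuchstabCert
import HarnessLib

/-!
# Route `FordMaynardSieveConst01651`, target `SieveConst01651` (stmt-Parity-19185), stub `stub_certValuePos` (R2):
# the rectangle sums of the checker as sums over the table entries

Def-free helper file (step (7) of the `certP`/`certN` soundness, see `…CertAssembly`): the checker accumulates
`certP = sumPos certBlockLo certG2` and `certN = sumNeg certBlockHi certG2` with `List.foldl`; here they are rewritten
as plain sums over the entries (`sumPos_eq_sum`, `sumNeg_eq_sum`, from the generic `foldl_add_eq`), and cast to `ℝ`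
(`cast_sumPos`, `cast_sumNeg`), which is the form the per-entry soundness argument consumes.

References: folklore.
-/

namespace Summit.Parity.GeneralizedHardyLittlewood.FordMaynardSieveConst01651SieveConst01651

/-- A conditional accumulating fold is the sum of the mapped list. [folklore] -/
theorem foldl_add_eq {ι : Type*} (g : ι → ℕ) : ∀ (l : List ι) (acc : ℕ),
    l.foldl (fun acc e => acc + g e) acc = acc + (l.map g).sum
  | [], acc => by simp
  | e :: l, acc => by
    rw [List.foldl_cons, foldl_add_eq g l, List.map_cons, List.sum_cons, Nat.add_assoc]

/-- **`sumPos` as a sum over the entries**: each entry with `c > 0` contributes the sum of `rectPos` over its inner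
rectangles, the others `0`. [folklore] -/
theorem sumPos_eq_sum (NL : ℕ) (ents : List (ℕ × ℕ × ℕ × ℤ)) :
    sumPos NL ents = (ents.map fun e => if 0 < e.2.2.2 then
      ((entryRects e.1 e.2.1 e.2.2.1 true).map (rectPos NL e.2.2.2.natAbs (if e.1 == e.2.1 then 2 else 1))).sum
      else 0).sum := by
  unfold sumPos
  have h := foldl_add_eq (fun e : ℕ × ℕ × ℕ × ℤ => if 0 < e.2.2.2 then
      ((entryRects e.1 e.2.1 e.2.2.1 true).map (rectPos NL e.2.2.2.natAbs (if e.1 == e.2.1 then 2 else 1))).sum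
      else 0) ents 0
  rw [zero_add] at h
  rw [← h]
  congr 1
  funext acc e
  split_ifs <;> simp

/-- **`sumNeg` as a sum over the entries**: each entry with `c < 0` contributes the sum of `rectNeg` over its outer
rectangles, the others `0`. [folklore] -/
theorem sumNeg_eq_sum (NH : ℕ) (ents : List (ℕ × ℕ × ℕ × ℤ)) :
    sumNeg NH ents = (ents.map fun e => if e.2.2.2 < 0 then
      ((entryRects e.1 e.2.1 e.2.2.1 false).map (rectNeg NH e.2.2.2.natAbs (if e.1 == e.2.1 then 2 else 1))).sum
      else 0).sum := by
  unfold sumNeg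
  have h := foldl_add_eq (fun e : ℕ × ℕ × ℕ × ℤ => if e.2.2.2 < 0 then
      ((entryRects e.1 e.2.1 e.2.2.1 false).map (rectNeg NH e.2.2.2.natAbs (if e.1 == e.2.1 then 2 else 1))).sum
      else 0) ents 0
  rw [zero_add] at h
  rw [← h]
  congr 1
  funext acc e
  split_ifs <;> simp

/-- `certP` over the reals as a sum over the table entries. [folklore] -/
theorem cast_certP : ((certP : ℕ) : ℝ) = (certG2.map fun e => if 0 < e.2.2.2 then
    (((entryRects e.1 e.2.1 e.2.2.1 true).map (rectPos certBlockLo e.2.2.2.natAbs (if e.1 == e.2.1 then 2 else 1))).sum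
      : ℝ) else 0).sum := by
  unfold certP
  rw [sumPos_eq_sum, Nat.cast_list_sum, List.map_map]
  congr 1
  refine List.map_congr_left fun e _ => ?_
  simp only [Function.comp_apply]
  split_ifs <;> simp

/-- `certN` over the reals as a sum over the table entries. [folklore] -/
theorem cast_certN : ((certN : ℕ) : ℝ) = (certG2.map fun e => if e.2.2.2 < 0 then
    (((entryRects e.1 e.2.1 e.2.2.1 false).map (rectNeg certBlockHi e.2.2.2.natAbs (if e.1 == e.2.1 then 2 else 1))).sum
      : ℝ) else 0).sum := by
  unfold certN
  rw [sumNeg_eq_sum, Nat.cast_list_sum, List.map_map]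
  congr 1
  refine List.map_congr_left fun e _ => ?_
  simp only [Function.comp_apply]
  split_ifs <;> simp

end Summit.Parity.GeneralizedHardyLittlewood.FordMaynardSieveConst01651SieveConst01651
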